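/-
Copyright (c) 2026 the pub-hodgecm-mathlib formalisation cell (harness21).  Prover seat hodgecm-mathlib-A-p12 (g35): P6b wave A seat 1 «FFGS-QUOT» (A), §E
part 3 «THE AFFINE QUOTIENT: RANK AND THE TORSOR CLAUSE» (dealer desk F0P6b-plan (g13) DEAL P6b-A1, director g34 s1734; box F0P6-ref1 (g8)), 2026-09-03.
-/
import Literature.AlgebraicGeometry.GroupSchemes.FiniteFlatGroupSchemeQuotientAffine
import Mathlib.RingTheory.Flat.LocallyFree
import Mathlib.LinearAlgebra.TensorProduct.Quotient
import HarnessLib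

/-!
# Quotient of an affine scheme by a free action of a finite locally free group scheme: rank `rk H` and the torsor clause `C ⊗[C₀] C ≅ C ⊗[R] H`

Topic `AlgebraicGeometry/GroupSchemes`; namespace `Literature.AlgebraicGeometry.GroupSchemes.FiniteFlatQuotientAffine` (sub-namespace = the object);
THEOREMS ONLY (no definition, instance, notation or named fact; one `private` plumbing lemma); Mathlib-footed over §A–§E.2 of the organ
(`…QuotientAffineTwist`, `…Integral`, `…BasisCriterion`, `…Local`, `…BaseChange`, `…QuotientAffine`).  Cell `pub/hodgecm-mathlib` (D-0151), organ
«FFGS-QUOT» (A) of the P6b fan-out sheet (desk F0P6b-plan (g13) `SOCKETS-P6b.fanout.v1` §0; signature sheet `WAVEA-SIGNATURES.v2`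
`sig_FFGSQ_A_torsorOverInvariants`), lane `--supports stmt-HodgeConjecture-24832`; count-neutral (banked Row-4B capital).  HC_CM is proved only modulo the
printed citations (2 remaining named inputs hLiu418 = `stmt-HodgeConjecture-24832`, h413 = `stmt-HodgeConjecture-24833`) until rung 0 closes.

THE THEOREM (`torsorOverInvariants`; [MumfordAV1970] §12 Thm. 1 (A) finiteness ∕ local freeness of `X → Y` and (B) `X` is a `Z`-torsor over `Y`; [SGA3I]
Exp. V Thm. 4.1 (ii)+(iv); [StacksProject] Tag 03BM).  `R` a commutative ring, `H` a commutative Hopf algebra FINITE FREE over `R`, `C` a commutative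
`R`-algebra OF FINITE TYPE with a coassociative counital FREE coaction `ρ : C →ₐ[R] C ⊗[R] H`, `C₀ := AlgHom.equalizer ρ includeLeft`.  THEN
`Module.Finite C₀ C ∧ Module.FaithfullyFlat C₀ C ∧ ker (productMap includeLeft ρ) = Ideal.span {c ⊗ 1 − 1 ⊗ c | c ∈ C₀}`.

THE PROOF of the new (third) conjunct.  RANK (`rankAtStalk_invariants_eq_card`): by §E.2, over the auxiliary local ring `B = C₀[X]_{𝔪[X]}` the module
`B ⊗[C₀] C` is free with a basis indexed by the basis index `ι` of `H` (`nonempty_basis_tensorProduct_of_aux`), so the free `(C₀)_𝔪`-module `C_𝔪` has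
rank `card ι` (`finrank_localization_tensorProduct_of_aux`), and ranks of the finite flat `C₀`-module `C` are constant under specialisation.  DESCENT OF THE
GALOIS MAP (`exists_lift_productMap`, `bijective_lift_productMap`): `θ̄ : C ⊗[C₀] C → C ⊗[R] H`, `m ⊗ n ↦ (m ⊗ 1)·ρ n`, is a surjection of finite flat
`C`-modules of the same rank `card ι` at every maximal ideal of `C` (Mathlib `Module.rankAtStalk_baseChange`), hence bijective (Mathlib
`Module.bijective_of_surjective_of_rankAtStalk_eq`).  KERNEL (`ker_productMap_eq_span`): `θ = θ̄ ∘ π`, so `ker θ = ker π` = the `C₀`-span of the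
`(c₀m) ⊗ n − m ⊗ (c₀n) = (m ⊗ n)(c₀ ⊗ 1 − 1 ⊗ c₀)` (Mathlib `TensorProduct.AlgebraTensorModule.ker_mapOfCompatibleSMul`), which lies in the ideal; the
reverse inclusion is `θ (c ⊗ 1 − 1 ⊗ c) = c ⊗ 1 − ρ c = 0` for `c` invariant.

## References
* [MumfordAV1970] D. Mumford, *Abelian Varieties* (1970), §12 «Quotients by finite group schemes», Thm. 1 p. 111, proof pp. 112–115 ((B): p. 114).
* [SGA3I] M. Demazure, A. Grothendieck (eds.), *SGA 3, Tome I*, Exp. V (P. Gabriel), Thm. 4.1 (ii), (iv) (re-edition p. 165 ∕ orig. p. 263).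
* [StacksProject] The Stacks Project, Tag 03BM (Prop. 39.23.9) and its proof; Tag 03C8 (Lemma 39.23.8).
-/

set_option autoImplicit false

namespace Literature.AlgebraicGeometry.GroupSchemes.FiniteFlatQuotientAffine

open TensorProduct

/-! ## §E.3a  Rank over the auxiliary ring; descent of the Galois map -/

section Descent

open Algebra.TensorProduct

variable {R : Type*} [CommRing R] {H : Type*} [CommRing H] [HopfAlgebra R H]
  {C : Type*} [CommRing C] [Algebra R C] (ρ : C →ₐ[R] C ⊗[R] H)

/-- **Local freeness over the auxiliary ring** ([StacksProject] Tag 03BM, proof, «we may apply Lemma 03C8»): `H` free on `ι`, `C` finite over its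
invariants `C₀`, the coaction coassociative, counital and free, `B` a local flat `C₀`-algebra with infinite residue field.  Then `B ⊗[C₀] C` has a
`B`-basis INDEXED BY `ι`: base change the coaction (§E.1), identify the invariants of `B ⊗[C₀] C` with `B`, and apply §D (a `ρ'`-basis exists in general
position; §C turns it into a basis of `B ⊗[C₀] C` over the invariants, transported to `B` by `Module.Basis.mapCoeffs`). [cite: StacksProject, Tag 03BM] -/
theorem nonempty_basis_tensorProduct_of_aux
    [Module.Finite (AlgHom.equalizer ρ (Algebra.TensorProduct.includeLeft : C →ₐ[R] C ⊗[R] H)) C]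
    (hcoassoc : ∀ c : C, TensorProduct.map LinearMap.id (Coalgebra.comul (R := R) (A := H)) (ρ c) =
      TensorProduct.assoc R C H H (TensorProduct.map ρ.toLinearMap LinearMap.id (ρ c)))
    (hcounit : ∀ c : C, TensorProduct.rid R C
      (TensorProduct.map LinearMap.id (Coalgebra.counit (R := R) (A := H)) (ρ c)) = c)
    (hfree : Function.Surjective
      (Algebra.TensorProduct.productMap (Algebra.TensorProduct.includeLeft : C →ₐ[R] C ⊗[R] H) ρ))
    {ι : Type*} [Fintype ι] (b : Module.Basis ι R H)
    (B : Type*) [CommRing B] [Algebra R B]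
    [Algebra (AlgHom.equalizer ρ (Algebra.TensorProduct.includeLeft : C →ₐ[R] C ⊗[R] H)) B]
    [IsScalarTower R (AlgHom.equalizer ρ (Algebra.TensorProduct.includeLeft : C →ₐ[R] C ⊗[R] H)) B]
    [IsLocalRing B] [Infinite (IsLocalRing.ResidueField B)] [Module.Flat (AlgHom.equalizer ρ (Algebra.TensorProduct.includeLeft : C →ₐ[R] C ⊗[R] H)) B] :
    Nonempty (Module.Basis ι B (B ⊗[(AlgHom.equalizer ρ (Algebra.TensorProduct.includeLeft : C →ₐ[R] C ⊗[R] H))] C)) := by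
  have hinv : ∀ b ∈ (AlgHom.equalizer ρ (Algebra.TensorProduct.includeLeft : C →ₐ[R] C ⊗[R] H)),
      ρ b = b ⊗ₜ[R] (1 : H) := fun b hb => (AlgHom.mem_equalizer _ _ _).1 hb
  have hinv' : ∀ c : C, ρ c = c ⊗ₜ[R] (1 : H) →
      c ∈ (AlgHom.equalizer ρ (Algebra.TensorProduct.includeLeft : C →ₐ[R] C ⊗[R] H)) := fun c hc => (AlgHom.mem_equalizer _ _ _).2 hc
  obtain ⟨ρ', hρ'⟩ := exists_coaction_baseChange ρ (AlgHom.equalizer ρ (Algebra.TensorProduct.includeLeft : C →ₐ[R] C ⊗[R] H)) hinv B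
  have hco' := coassoc_coaction_baseChange ρ (AlgHom.equalizer ρ (Algebra.TensorProduct.includeLeft : C →ₐ[R] C ⊗[R] H)) B ρ' hρ' hcoassoc
  have hcu' := counit_coaction_baseChange ρ (AlgHom.equalizer ρ (Algebra.TensorProduct.includeLeft : C →ₐ[R] C ⊗[R] H)) B ρ' hρ' hcounit
  have hfr' := surjective_productMap_coaction_baseChange ρ (AlgHom.equalizer ρ (Algebra.TensorProduct.includeLeft : C →ₐ[R] C ⊗[R] H)) B ρ' hρ' hfree
  have hE := equalizer_coaction_baseChange_eq_range ρ (AlgHom.equalizer ρ (Algebra.TensorProduct.includeLeft : C →ₐ[R] C ⊗[R] H)) hinv B ρ' hρ' hinv'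
  obtain ⟨e, he⟩ := exists_ringEquiv_equalizer_baseChange (AlgHom.equalizer ρ (Algebra.TensorProduct.includeLeft : C →ₐ[R] C ⊗[R] H)) B ρ' hE
  haveI : Nontrivial (AlgHom.equalizer ρ'
      (Algebra.TensorProduct.includeLeft :
        B ⊗[(AlgHom.equalizer ρ (Algebra.TensorProduct.includeLeft : C →ₐ[R] C ⊗[R] H))] C →ₐ[R]
          (B ⊗[(AlgHom.equalizer ρ (Algebra.TensorProduct.includeLeft : C →ₐ[R] C ⊗[R] H))] C) ⊗[R] H)) := e.injective.nontrivial
  haveI : IsLocalHom e.toRingHom := ⟨fun a ha => (MulEquiv.isUnit_map e).1 ha⟩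
  haveI : IsLocalRing (AlgHom.equalizer ρ'
      (Algebra.TensorProduct.includeLeft :
        B ⊗[(AlgHom.equalizer ρ (Algebra.TensorProduct.includeLeft : C →ₐ[R] C ⊗[R] H))] C →ₐ[R]
          (B ⊗[(AlgHom.equalizer ρ (Algebra.TensorProduct.includeLeft : C →ₐ[R] C ⊗[R] H))] C) ⊗[R] H)) :=
    IsLocalRing.of_surjective e.toRingHom e.surjective
  haveI : Infinite (IsLocalRing.ResidueField (AlgHom.equalizer ρ'
      (Algebra.TensorProduct.includeLeft :
        B ⊗[(AlgHom.equalizer ρ (Algebra.TensorProduct.includeLeft : C →ₐ[R] C ⊗[R] H))] C →ₐ[R]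
          (B ⊗[(AlgHom.equalizer ρ (Algebra.TensorProduct.includeLeft : C →ₐ[R] C ⊗[R] H))] C) ⊗[R] H))) :=
    Infinite.of_injective _ (IsLocalRing.ResidueField.mapEquiv e).injective
  haveI : Finite (MaximalSpectrum (B ⊗[(AlgHom.equalizer ρ (Algebra.TensorProduct.includeLeft : C →ₐ[R] C ⊗[R] H))] C)) :=
    Literature.RingTheory.OrderOfVanishing.finite_maximalSpectrum B (B ⊗[(AlgHom.equalizer ρ (Algebra.TensorProduct.includeLeft : C →ₐ[R] C ⊗[R] H))] C)
  obtain ⟨x, β', hβ'⟩ := exists_basis_coaction_of_isLocalRing ρ' b hfr'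
  obtain ⟨β₀, -⟩ := exists_basis_invariants ρ' x β' hβ' hco' hcu'
  have hsmul : ∀ (c : AlgHom.equalizer ρ'
      (Algebra.TensorProduct.includeLeft :
        B ⊗[(AlgHom.equalizer ρ (Algebra.TensorProduct.includeLeft : C →ₐ[R] C ⊗[R] H))] C →ₐ[R]
          (B ⊗[(AlgHom.equalizer ρ (Algebra.TensorProduct.includeLeft : C →ₐ[R] C ⊗[R] H))] C) ⊗[R] H))
      (y : B ⊗[(AlgHom.equalizer ρ (Algebra.TensorProduct.includeLeft : C →ₐ[R] C ⊗[R] H))] C),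
      e.symm c • y = c • y := by
    intro c y
    obtain ⟨b', rfl⟩ := e.surjective c
    rw [e.symm_apply_apply, Subalgebra.smul_def, he, Algebra.TensorProduct.algebraMap_apply, Algebra.algebraMap_self,
      RingHom.id_apply]
    induction y using TensorProduct.induction_on with
    | zero => simp
    | tmul b'' c' => rw [TensorProduct.smul_tmul', smul_eq_mul, smul_eq_mul, Algebra.TensorProduct.tmul_mul_tmul, one_mul]
    | add u v hu hv => rw [smul_add, smul_add, hu, hv]
  exact ⟨β₀.mapCoeffs e.symm hsmul⟩

/-- **The rank of `C_𝔪` over `(C₀)_𝔪` is `rk H`** ([MumfordAV1970] §12 Thm. 1 (A), proof p. 112 «`C` is locally free of rank `n = rk H` over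
`C₀`»): with `B` as in `nonempty_basis_tensorProduct_of_aux` receiving `g : (C₀)_𝔪 → B` over `C₀`, the finite flat hence free `(C₀)_𝔪`-module
`(C₀)_𝔪 ⊗[C₀] C` has rank `card ι`, read off after the base change `B ⊗[(C₀)_𝔪] ((C₀)_𝔪 ⊗[C₀] C) ≅ B ⊗[C₀] C` (Mathlib `Module.finrank_baseChange`,
`AlgebraTensorModule.cancelBaseChange`, `Module.free_of_flat_of_isLocalRing`). [cite: MumfordAV1970, §12 Thm. 1 (A) proof p. 112] -/
theorem finrank_localization_tensorProduct_of_aux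
    [Module.Finite (AlgHom.equalizer ρ (Algebra.TensorProduct.includeLeft : C →ₐ[R] C ⊗[R] H)) C]
    [Module.Flat (AlgHom.equalizer ρ (Algebra.TensorProduct.includeLeft : C →ₐ[R] C ⊗[R] H)) C]
    (hcoassoc : ∀ c : C, TensorProduct.map LinearMap.id (Coalgebra.comul (R := R) (A := H)) (ρ c) =
      TensorProduct.assoc R C H H (TensorProduct.map ρ.toLinearMap LinearMap.id (ρ c)))
    (hcounit : ∀ c : C, TensorProduct.rid R C
      (TensorProduct.map LinearMap.id (Coalgebra.counit (R := R) (A := H)) (ρ c)) = c)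
    (hfree : Function.Surjective
      (Algebra.TensorProduct.productMap (Algebra.TensorProduct.includeLeft : C →ₐ[R] C ⊗[R] H) ρ))
    {ι : Type*} [Fintype ι] (b : Module.Basis ι R H)
    (𝔪 : Ideal (AlgHom.equalizer ρ (Algebra.TensorProduct.includeLeft : C →ₐ[R] C ⊗[R] H))) [𝔪.IsMaximal]
    (B : Type*) [CommRing B] [Algebra R B]
    [Algebra (AlgHom.equalizer ρ (Algebra.TensorProduct.includeLeft : C →ₐ[R] C ⊗[R] H)) B]
    [IsScalarTower R (AlgHom.equalizer ρ (Algebra.TensorProduct.includeLeft : C →ₐ[R] C ⊗[R] H)) B]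
    [IsLocalRing B] [Infinite (IsLocalRing.ResidueField B)] [Module.Flat (AlgHom.equalizer ρ (Algebra.TensorProduct.includeLeft : C →ₐ[R] C ⊗[R] H)) B]
    (g : Localization.AtPrime 𝔪 →+* B)
    (hg : g.comp (algebraMap (AlgHom.equalizer ρ (Algebra.TensorProduct.includeLeft : C →ₐ[R] C ⊗[R] H)) (Localization.AtPrime 𝔪)) =
      algebraMap (AlgHom.equalizer ρ (Algebra.TensorProduct.includeLeft : C →ₐ[R] C ⊗[R] H)) B) :
    Module.finrank (Localization.AtPrime 𝔪)
      (Localization.AtPrime 𝔪 ⊗[(AlgHom.equalizer ρ (Algebra.TensorProduct.includeLeft : C →ₐ[R] C ⊗[R] H))] C) = Fintype.card ι := by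
  obtain ⟨β⟩ := nonempty_basis_tensorProduct_of_aux ρ hcoassoc hcounit hfree b B
  letI : Algebra (Localization.AtPrime 𝔪) B := g.toAlgebra
  haveI : IsScalarTower (AlgHom.equalizer ρ (Algebra.TensorProduct.includeLeft : C →ₐ[R] C ⊗[R] H)) (Localization.AtPrime 𝔪) B :=
    IsScalarTower.of_algebraMap_eq fun a => by
      rw [RingHom.algebraMap_toAlgebra, ← RingHom.comp_apply, hg]
  haveI : Module.Free (Localization.AtPrime 𝔪) (Localization.AtPrime 𝔪 ⊗[(AlgHom.equalizer ρ (Algebra.TensorProduct.includeLeft : C →ₐ[R] C ⊗[R] H))] C) :=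
    Module.free_of_flat_of_isLocalRing (R := Localization.AtPrime 𝔪)
      (P := Localization.AtPrime 𝔪 ⊗[(AlgHom.equalizer ρ (Algebra.TensorProduct.includeLeft : C →ₐ[R] C ⊗[R] H))] C)
  let e : B ⊗[Localization.AtPrime 𝔪] (Localization.AtPrime 𝔪 ⊗[(AlgHom.equalizer ρ (Algebra.TensorProduct.includeLeft : C →ₐ[R] C ⊗[R] H))] C) ≃ₗ[B]
      B ⊗[(AlgHom.equalizer ρ (Algebra.TensorProduct.includeLeft : C →ₐ[R] C ⊗[R] H))] C :=
    TensorProduct.AlgebraTensorModule.cancelBaseChange _ (Localization.AtPrime 𝔪) B B C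
  rw [← Module.finrank_baseChange (R := B), e.finrank_eq, Module.finrank_eq_card_basis β]

/-- **The Galois map descends to `C ⊗[C₀] C`** ([MumfordAV1970] §12 Thm. 1 (B) proof p. 114, the map `C ⊗_{C₀} C → C ⊗_R H`; [StacksProject]
Tag 03BM second half): since `ρ` is `C₀`-linear (`ρ c₀ = c₀ ⊗ 1`), `m ⊗ n ↦ (m ⊗ 1)·ρ n` is well defined on `C ⊗[C₀] C` and is a `C`-ALGEBRA map for the
left `C`-structures (Mathlib `Algebra.TensorProduct.lift`). [cite: MumfordAV1970, §12 Thm. 1 proof p. 114] -/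
theorem exists_lift_productMap :
    ∃ θ' : C ⊗[(AlgHom.equalizer ρ (Algebra.TensorProduct.includeLeft : C →ₐ[R] C ⊗[R] H))] C →ₐ[C] C ⊗[R] H,
      ∀ m n : C, θ' (m ⊗ₜ[(AlgHom.equalizer ρ (Algebra.TensorProduct.includeLeft : C →ₐ[R] C ⊗[R] H))] n) = (m ⊗ₜ[R] (1 : H)) * ρ n := by
  let ρ₀ : C →ₐ[(AlgHom.equalizer ρ (Algebra.TensorProduct.includeLeft : C →ₐ[R] C ⊗[R] H))] C ⊗[R] H :=
    { ρ.toRingHom with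
      commutes' := fun a => by
        change ρ (a : C) = algebraMap (AlgHom.equalizer ρ (Algebra.TensorProduct.includeLeft : C →ₐ[R] C ⊗[R] H)) (C ⊗[R] H) a
        rw [IsScalarTower.algebraMap_apply (AlgHom.equalizer ρ (Algebra.TensorProduct.includeLeft : C →ₐ[R] C ⊗[R] H)) C (C ⊗[R] H) a]
        simpa using (AlgHom.mem_equalizer _ _ _).1 a.2 }
  exact ⟨Algebra.TensorProduct.lift (Algebra.TensorProduct.includeLeft (S := C)) ρ₀
    (fun _ _ => Commute.all _ _), fun m n => rfl⟩

/-- The descended Galois map composed with the projection `C ⊗[R] C → C ⊗[C₀] C` (Mathlib `TensorProduct.mapOfCompatibleSMul`) is the Galois map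
`productMap includeLeft ρ` itself. [cite: MumfordAV1970, §12 Thm. 1 proof p. 114] -/
theorem lift_productMap_comp
    (θ' : C ⊗[(AlgHom.equalizer ρ (Algebra.TensorProduct.includeLeft : C →ₐ[R] C ⊗[R] H))] C →ₐ[C] C ⊗[R] H)
    (hθ' : ∀ m n : C, θ' (m ⊗ₜ[(AlgHom.equalizer ρ (Algebra.TensorProduct.includeLeft : C →ₐ[R] C ⊗[R] H))] n) = (m ⊗ₜ[R] (1 : H)) * ρ n) (x : C ⊗[R] C) :
    θ' (TensorProduct.mapOfCompatibleSMul (AlgHom.equalizer ρ (Algebra.TensorProduct.includeLeft : C →ₐ[R] C ⊗[R] H)) R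
      (AlgHom.equalizer ρ (Algebra.TensorProduct.includeLeft : C →ₐ[R] C ⊗[R] H)) C C x) =
      Algebra.TensorProduct.productMap (Algebra.TensorProduct.includeLeft : C →ₐ[R] C ⊗[R] H) ρ x := by
  induction x using TensorProduct.induction_on with
  | zero => simp only [map_zero]
  | tmul m n =>
    rw [TensorProduct.mapOfCompatibleSMul_tmul, hθ', Algebra.TensorProduct.productMap_apply_tmul]
    rfl
  | add x y hx hy => simp only [map_add, hx, hy]

/-- The `C₀`-scalar action on `C ⊗[R] C` is multiplication by `c₀ ⊗ 1`. [folklore] -/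
private theorem invariants_smul_eq_tmul_mul (a : (AlgHom.equalizer ρ (Algebra.TensorProduct.includeLeft : C →ₐ[R] C ⊗[R] H))) (x : C ⊗[R] C) :
    a • x = ((a : C) ⊗ₜ[R] (1 : C)) * x := by
  induction x using TensorProduct.induction_on with
  | zero => simp
  | tmul m n =>
    simp [TensorProduct.smul_tmul', Algebra.TensorProduct.tmul_mul_tmul, Subalgebra.smul_def]
  | add x y hx hy => simp [smul_add, mul_add, hx, hy]

end Descent

/-! ## §E.3b  The rank of `C` over `C₀`, bijectivity of `C ⊗[C₀] C → C ⊗[R] H`, the torsor clause, the theorem -/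

section Main

open Algebra.TensorProduct

variable {R : Type*} [CommRing R] {H : Type*} [CommRing H] [HopfAlgebra R H] [Module.Free R H] [Module.Finite R H]
  {C : Type*} [CommRing C] [Algebra R C] (ρ : C →ₐ[R] C ⊗[R] H)

/-- **`C` is locally free of rank `rk H` over `C₀`** ([MumfordAV1970] §12 Thm. 1 (A) proof p. 112; [SGA3I] Exp. V Thm. 4.1 (iv) «fini localement
libre»): for `H` finite free with basis indexed by `ι` and `C` of finite type with a coassociative counital free coaction, `Module.rankAtStalk C 𝔭 = card ι`
at every prime `𝔭` of the invariants (ranks of a finite flat module are constant under specialisation, Mathlib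
`Module.rankAtStalk_eq_of_le_of_finite_of_flat'`; at a maximal ideal use the auxiliary ring `C₀[X]_{𝔪[X]}` of §E.2 and
`finrank_localization_tensorProduct_of_aux`). [cite: MumfordAV1970, §12 Thm. 1 (A) proof p. 112] -/
theorem rankAtStalk_invariants_eq_card [Algebra.FiniteType R C]
    (hcoassoc : ∀ c : C, TensorProduct.map LinearMap.id (Coalgebra.comul (R := R) (A := H)) (ρ c) =
      TensorProduct.assoc R C H H (TensorProduct.map ρ.toLinearMap LinearMap.id (ρ c)))
    (hcounit : ∀ c : C, TensorProduct.rid R C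
      (TensorProduct.map LinearMap.id (Coalgebra.counit (R := R) (A := H)) (ρ c)) = c)
    (hfree : Function.Surjective
      (Algebra.TensorProduct.productMap (Algebra.TensorProduct.includeLeft : C →ₐ[R] C ⊗[R] H) ρ))
    {ι : Type*} [Fintype ι] (b : Module.Basis ι R H)
    (𝔭 : PrimeSpectrum (AlgHom.equalizer ρ (Algebra.TensorProduct.includeLeft : C →ₐ[R] C ⊗[R] H))) :
    Module.rankAtStalk (R := (AlgHom.equalizer ρ (Algebra.TensorProduct.includeLeft : C →ₐ[R] C ⊗[R] H))) C 𝔭 = Fintype.card ι := by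
  haveI : Module.Finite (AlgHom.equalizer ρ (Algebra.TensorProduct.includeLeft : C →ₐ[R] C ⊗[R] H)) C := finite_invariants ρ hcoassoc hcounit
  haveI : Module.Flat (AlgHom.equalizer ρ (Algebra.TensorProduct.includeLeft : C →ₐ[R] C ⊗[R] H)) C := flat_invariants ρ hcoassoc hcounit hfree
  obtain ⟨𝔪, h𝔪, hle⟩ := Ideal.exists_le_maximal 𝔭.asIdeal 𝔭.isPrime.ne_top
  rw [show 𝔭 = ⟨𝔭.asIdeal, 𝔭.isPrime⟩ from rfl,
    Module.rankAtStalk_eq_of_le_of_finite_of_flat' C (hq := h𝔪.isPrime) hle,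
    Module.rankAtStalk_eq_finrank_tensorProduct]
  haveI hP : (Ideal.map (Polynomial.C : _ →+* Polynomial _) 𝔪).IsPrime := Ideal.isPrime_map_C_of_isPrime
  obtain ⟨hflat, hinf, g, -, hg⟩ := exists_localization_polynomial_infinite_residueField _ 𝔪
  haveI := hflat
  haveI := hinf
  exact finrank_localization_tensorProduct_of_aux ρ hcoassoc hcounit hfree b 𝔪
    (Localization.AtPrime (Ideal.map (Polynomial.C : _ →+* Polynomial _) 𝔪)) g hg

/-- **The descended Galois map `C ⊗[C₀] C → C ⊗[R] H` is an ISOMORPHISM** ([MumfordAV1970] §12 Thm. 1 (B) proof p. 114 «both sides are free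
`C`-modules of rank `n`, and the map is surjective, hence an isomorphism»; [StacksProject] Tag 03BM second half): it is onto because the Galois map is
(freeness of the action), both sides are finite flat `C`-modules (base change of `C` over `C₀`, resp. of `H` over `R`) of the same rank `card ι` at every
maximal ideal of `C` (`rankAtStalk_invariants_eq_card` + Mathlib `Module.rankAtStalk_baseChange`, resp. freeness), so Mathlib
`Module.bijective_of_surjective_of_rankAtStalk_eq` applies. [cite: MumfordAV1970, §12 Thm. 1 proof p. 114] -/
theorem bijective_lift_productMap [Algebra.FiniteType R C]
    (hcoassoc : ∀ c : C, TensorProduct.map LinearMap.id (Coalgebra.comul (R := R) (A := H)) (ρ c) =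
      TensorProduct.assoc R C H H (TensorProduct.map ρ.toLinearMap LinearMap.id (ρ c)))
    (hcounit : ∀ c : C, TensorProduct.rid R C
      (TensorProduct.map LinearMap.id (Coalgebra.counit (R := R) (A := H)) (ρ c)) = c)
    (hfree : Function.Surjective
      (Algebra.TensorProduct.productMap (Algebra.TensorProduct.includeLeft : C →ₐ[R] C ⊗[R] H) ρ))
    (θ' : C ⊗[(AlgHom.equalizer ρ (Algebra.TensorProduct.includeLeft : C →ₐ[R] C ⊗[R] H))] C →ₐ[C] C ⊗[R] H)
    (hθ' : ∀ m n : C, θ' (m ⊗ₜ[(AlgHom.equalizer ρ (Algebra.TensorProduct.includeLeft : C →ₐ[R] C ⊗[R] H))] n) = (m ⊗ₜ[R] (1 : H)) * ρ n) :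
    Function.Bijective θ' := by
  haveI : Module.Finite (AlgHom.equalizer ρ (Algebra.TensorProduct.includeLeft : C →ₐ[R] C ⊗[R] H)) C := finite_invariants ρ hcoassoc hcounit
  haveI : Module.Flat (AlgHom.equalizer ρ (Algebra.TensorProduct.includeLeft : C →ₐ[R] C ⊗[R] H)) C := flat_invariants ρ hcoassoc hcounit hfree
  let b := Module.Free.chooseBasis R H
  have hsurj : Function.Surjective θ'.toLinearMap := by
    intro y
    obtain ⟨x, rfl⟩ := hfree y
    exact ⟨_, lift_productMap_comp ρ θ' hθ' x⟩
  change Function.Bijective θ'.toLinearMap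
  refine Module.bijective_of_surjective_of_rankAtStalk_eq hsurj fun m hm => ?_
  haveI : Nontrivial C := by
    rcases subsingleton_or_nontrivial C with h | h
    · exact absurd (Subsingleton.elim _ _) hm.ne_top
    · exact h
  rw [Module.rankAtStalk_baseChange, rankAtStalk_invariants_eq_card ρ hcoassoc hcounit hfree b]
  simp only [Module.rankAtStalk_eq_finrank_of_free, Pi.natCast_apply, Nat.cast_id,
    Module.finrank_eq_card_basis (Algebra.TensorProduct.basis C b)]

/-- **Conjunct 3 of (A): the torsor clause** ([MumfordAV1970] §12 Thm. 1 (B) «`X ≅` the `Y`-torsor: `C ⊗_{C₀} C ≅ C ⊗_R H`», ring form; [SGA3I]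
Exp. V Thm. 4.1 (iv) «le couple d'équivalence est effectif»; [StacksProject] Tag 03BM «`X ×_Y X ≅ R`»): the kernel of the Galois map
`θ = productMap includeLeft ρ : C ⊗[R] C → C ⊗[R] H` is the ideal generated by the `c ⊗ 1 − 1 ⊗ c`, `c ∈ C₀`.  PROOF: `θ = θ̄ ∘ π` with
`π : C ⊗[R] C → C ⊗[C₀] C` and `θ̄` bijective (`bijective_lift_productMap`), so `ker θ = ker π`, which Mathlib
`TensorProduct.AlgebraTensorModule.ker_mapOfCompatibleSMul` identifies with the `C₀`-span of the `(c₀ m) ⊗ n − m ⊗ (c₀ n) = (m ⊗ n)(c₀ ⊗ 1 − 1 ⊗ c₀)`.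
[cite: MumfordAV1970, §12 Thm. 1 p. 111] -/
theorem ker_productMap_eq_span [Algebra.FiniteType R C]
    (hcoassoc : ∀ c : C, TensorProduct.map LinearMap.id (Coalgebra.comul (R := R) (A := H)) (ρ c) =
      TensorProduct.assoc R C H H (TensorProduct.map ρ.toLinearMap LinearMap.id (ρ c)))
    (hcounit : ∀ c : C, TensorProduct.rid R C
      (TensorProduct.map LinearMap.id (Coalgebra.counit (R := R) (A := H)) (ρ c)) = c)
    (hfree : Function.Surjective
      (Algebra.TensorProduct.productMap (Algebra.TensorProduct.includeLeft : C →ₐ[R] C ⊗[R] H) ρ)) :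
    RingHom.ker (Algebra.TensorProduct.productMap
        (Algebra.TensorProduct.includeLeft : C →ₐ[R] C ⊗[R] H) ρ).toRingHom =
      Ideal.span {x : C ⊗[R] C | ∃ c ∈ (AlgHom.equalizer ρ (Algebra.TensorProduct.includeLeft : C →ₐ[R] C ⊗[R] H)),
        x = c ⊗ₜ[R] (1 : C) - (1 : C) ⊗ₜ[R] c} := by
  obtain ⟨θ', hθ'⟩ := exists_lift_productMap ρ
  have hbij := bijective_lift_productMap ρ hcoassoc hcounit hfree θ' hθ'
  apply le_antisymm
  · intro x hx
    have hx' : Algebra.TensorProduct.productMap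
        (Algebra.TensorProduct.includeLeft : C →ₐ[R] C ⊗[R] H) ρ x = 0 := hx
    have hπ : TensorProduct.mapOfCompatibleSMul (AlgHom.equalizer ρ (Algebra.TensorProduct.includeLeft : C →ₐ[R] C ⊗[R] H)) R
        (AlgHom.equalizer ρ (Algebra.TensorProduct.includeLeft : C →ₐ[R] C ⊗[R] H)) C C x = 0 :=
      hbij.1 (by rw [lift_productMap_comp ρ θ' hθ', hx', map_zero])
    have hmem : x ∈ LinearMap.ker (TensorProduct.mapOfCompatibleSMul (AlgHom.equalizer ρ (Algebra.TensorProduct.includeLeft : C →ₐ[R] C ⊗[R] H)) R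
        (AlgHom.equalizer ρ (Algebra.TensorProduct.includeLeft : C →ₐ[R] C ⊗[R] H)) C C) := hπ
    rw [TensorProduct.AlgebraTensorModule.ker_mapOfCompatibleSMul (AlgHom.equalizer ρ (Algebra.TensorProduct.includeLeft : C →ₐ[R] C ⊗[R] H)) C (N := C) (R := R)] at hmem
    refine Submodule.span_induction ?_ ?_ ?_ ?_ hmem
    · rintro y ⟨a, m, n, rfl⟩
      have : (a • m) ⊗ₜ[R] n - m ⊗ₜ[R] (a • n) =
          (m ⊗ₜ[R] n) * ((a : C) ⊗ₜ[R] (1 : C) - (1 : C) ⊗ₜ[R] (a : C)) := by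
        rw [mul_sub, Algebra.TensorProduct.tmul_mul_tmul, Algebra.TensorProduct.tmul_mul_tmul, mul_one,
          mul_one, Subalgebra.smul_def, Subalgebra.smul_def, smul_eq_mul, smul_eq_mul, mul_comm m,
          mul_comm n]
      rw [this]
      exact Ideal.mul_mem_left _ _ (Ideal.subset_span ⟨a, a.2, rfl⟩)
    · exact Ideal.zero_mem _
    · intro y z _ _ hy hz
      exact Ideal.add_mem _ hy hz
    · intro a y _ hy
      convert Ideal.mul_mem_left _ ((a : C) ⊗ₜ[R] (1 : C)) hy using 1
      exact invariants_smul_eq_tmul_mul ρ a y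
  · rw [Ideal.span_le]
    rintro x ⟨c, hc, rfl⟩
    rw [SetLike.mem_coe, RingHom.mem_ker]
    change Algebra.TensorProduct.productMap
        (Algebra.TensorProduct.includeLeft : C →ₐ[R] C ⊗[R] H) ρ (c ⊗ₜ[R] 1 - 1 ⊗ₜ[R] c) = 0
    rw [map_sub, Algebra.TensorProduct.productMap_apply_tmul, Algebra.TensorProduct.productMap_apply_tmul,
      map_one, map_one, mul_one, one_mul, ← (AlgHom.mem_equalizer _ _ _).1 hc, sub_self]

/-- **[MumfordAV1970] §12 Theorem 1 (A)+(B) ∕ [SGA3I] Exp. V Thm. 4.1 ∕ [StacksProject] Tag 03BM — ring form, all three conjuncts** (the signature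
sheet's `sig_FFGSQ_A_torsorOverInvariants` with `[Module.Finite R H] [Module.Flat R H] [IsNoetherianRing R]` replaced by `[Module.Free R H]
[Module.Finite R H]` and the budgeted `[Algebra.FiniteType R C]` added): for a commutative Hopf algebra `H` finite free over a commutative ring `R`
coacting coassociatively, counitally and FREELY on a commutative `R`-algebra `C` of finite type, with invariants `C₀ = AlgHom.equalizer ρ includeLeft`:
`C` is FINITE and FAITHFULLY FLAT over `C₀`, and the kernel of `C ⊗[R] C → C ⊗[R] H`, `m ⊗ n ↦ (m ⊗ 1)·ρ n`, is generated by the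
`c ⊗ 1 − 1 ⊗ c`, `c ∈ C₀` (i.e. `X → Spec C₀` is finite locally free and `X` is a `Z`-torsor over it). [cite: MumfordAV1970, §12 Thm. 1 p. 111] -/
theorem torsorOverInvariants [Algebra.FiniteType R C]
    (hcoassoc : ∀ c : C, TensorProduct.map LinearMap.id (Coalgebra.comul (R := R) (A := H)) (ρ c) =
      TensorProduct.assoc R C H H (TensorProduct.map ρ.toLinearMap LinearMap.id (ρ c)))
    (hcounit : ∀ c : C, TensorProduct.rid R C
      (TensorProduct.map LinearMap.id (Coalgebra.counit (R := R) (A := H)) (ρ c)) = c)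
    (hfree : Function.Surjective
      (Algebra.TensorProduct.productMap (Algebra.TensorProduct.includeLeft : C →ₐ[R] C ⊗[R] H) ρ)) :
    Module.Finite (AlgHom.equalizer ρ (Algebra.TensorProduct.includeLeft : C →ₐ[R] C ⊗[R] H)) C ∧
      Module.FaithfullyFlat (AlgHom.equalizer ρ (Algebra.TensorProduct.includeLeft : C →ₐ[R] C ⊗[R] H)) C ∧
      RingHom.ker (Algebra.TensorProduct.productMap
        (Algebra.TensorProduct.includeLeft : C →ₐ[R] C ⊗[R] H) ρ).toRingHom =
      Ideal.span {x : C ⊗[R] C | ∃ c ∈ (AlgHom.equalizer ρ (Algebra.TensorProduct.includeLeft : C →ₐ[R] C ⊗[R] H)), x = c ⊗ₜ[R] (1 : C) - (1 : C) ⊗ₜ[R] c} :=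
  ⟨(finite_faithfullyFlat_invariants ρ hcoassoc hcounit hfree).1,
    (finite_faithfullyFlat_invariants ρ hcoassoc hcounit hfree).2,
    ker_productMap_eq_span ρ hcoassoc hcounit hfree⟩

end Main

end Literature.AlgebraicGeometry.GroupSchemes.FiniteFlatQuotientAffine
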